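import Mathlib
import Summits.Ventures.HodgeRepro.Tier4.Line4.UltrametricCoords
import Summits.Ventures.HodgeRepro.Tier4.Line4.QadicBounds
import Summits.Ventures.HodgeRepro.Tier4.Line4.CentralScalars
import Summits.Ventures.HodgeRepro.Tier4.Line4.OrbitBlocks

/-!
# Tier4/Line4/LevelCongruenceLocal — the local half of P2: the adelic block relation, the `v`-adic block-scalar
congruence for ONE pair `(i, j)`, and the local scalar algebra

Blind re-derivation cell `pub-hodge-repro`, Tier 4 «prove the step» (README §9–§10), seat t4-L2-p3 (gen 5; plan-4 g5's
ruling S15514, statement S15538).  Tree path `lean/Summits/Ventures/HodgeRepro/Tier4/Line4/LevelCongruenceLocal.lean`.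
Imports this seat's `UltrametricCoords` (`coords_near_one`) and `QadicBounds` (the local bridge), OrbitBlocks
(`adMat_mul_decomp`, `decomp_mul_adMat`, `exists_col_ne_zero`) and LineScalars / CentralScalars (the `E′_𝔸`-scalars).

* `block_eq'`: OrbitBlocks' block relation `P_i · mat (b γ b′) · Q_j = (e_i e′_j) · (P_i · mat γ · Q_j)` for an
  ARBITRARY unitary middle factor `γ` (only `γ Ω = Ω γ` is used);
* `map_mulVec_single`, `comp_single_one`, `map_mulVec_comp`: columns and coordinate vectors read in `k_v`;
* **`block_scalar_near_one`** (ONE pair): with `x, y ∈ K(N) γ₀,f K(N)` and `P_i y Q_j = esc A B · P_i x Q_j`, the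
  `v`-components of `A − 1` and `B` are `≤ M² δ`, `δ = M (|N|_v M) M` (`M ≥ 1` a bound of the rational constants,
  `M² δ < 1`) — `coords_near_one` on the column `j₀` of the rational block `P_i g₀ Q_j` with its coordinate matrix `R`;
* `scalar_apply_le`, `scalar_mul_scalar`, `esc_sub_one`, `map_Omega_sq`, `pow_mul_inv_pow_eq`: the local scalar algebra
  and the exponent arithmetic used by the assembly (`Tier4/Line4/LevelCongruence`).

No printed input is consumed.  HC_CM is NOT proved by anyone in this repository.
-/

set_option autoImplicit false
noncomputable section
namespace Summit.Ventures.HodgeRepro.Tier4.Line4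
open Summit.Ventures.HodgeRepro.Tier4 Summit.Ventures.HodgeRepro.Tier4.Common
  Summit.Ventures.HodgeRepro.Tier4.Line1 NumberField IsDedekindDomain Matrix
open scoped NumberField Pointwise

section BlockRelation
variable {k : Type} [Field k] [NumberField k] (W : PlaneData k)

/-- **the blocks of `b γ b′` for an ARBITRARY unitary middle factor** (OrbitBlocks' `block_eq` with `adMat g₀`
replaced by any adelic matrix commuting with `Ω`): `P_i · mat (b γ b′) · Q_j = (e_i e′_j) · (P_i · mat γ · Q_j)`. -/
theorem block_eq' (x y x' y' : Fin 2 → Ad k) {b b' γ : GA W}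
    (hb : GA.mat W b = esc W (x 0) (y 0) * adMat k (W.P 0) + esc W (x 1) (y 1) * adMat k (W.P 1))
    (hb' : GA.mat W b' = esc W (x' 0) (y' 0) * adMat k (W.Q 0) + esc W (x' 1) (y' 1) * adMat k (W.Q 1))
    (hγΩ : GA.mat W γ * adMat k W.Ω = adMat k W.Ω * GA.mat W γ) (i j : Fin 2) :
    adMat k (W.P i) * GA.mat W (b * γ * b') * adMat k (W.Q j) =
      esc W (x i) (y i) * esc W (x' j) (y' j) * (adMat k (W.P i) * GA.mat W γ * adMat k (W.Q j)) := by
  have hPb : adMat k (W.P i) * GA.mat W b = esc W (x i) (y i) * adMat k (W.P i) := by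
    rw [hb]
    exact adMat_mul_decomp W W.P W.P_comm W.P_idem W.P_sum x y i
  have hb'Q : GA.mat W b' * adMat k (W.Q j) = esc W (x' j) (y' j) * adMat k (W.Q j) := by
    rw [hb']
    exact decomp_mul_adMat W W.Q W.Q_idem W.Q_sum x' y' j
  have hcomm1 : adMat k (W.P i) * esc W (x' j) (y' j) = esc W (x' j) (y' j) * adMat k (W.P i) :=
    (esc_mul_adMat_comm W _ _ (W.P_comm i)).symm
  have hcomm2 : GA.mat W γ * esc W (x' j) (y' j) = esc W (x' j) (y' j) * GA.mat W γ :=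
    (esc_mul_comm W _ _ _ hγΩ).symm
  calc adMat k (W.P i) * GA.mat W (b * γ * b') * adMat k (W.Q j)
      = (adMat k (W.P i) * GA.mat W b) * GA.mat W γ * (GA.mat W b' * adMat k (W.Q j)) := by
        simp only [GA.mat_mul, mul_assoc]
    _ = esc W (x i) (y i) * (adMat k (W.P i) * (GA.mat W γ * esc W (x' j) (y' j))) * adMat k (W.Q j) := by
        rw [hPb, hb'Q]
        simp only [mul_assoc]
    _ = esc W (x i) (y i) * esc W (x' j) (y' j) * (adMat k (W.P i) * GA.mat W γ * adMat k (W.Q j)) := by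
        rw [hcomm2, ← mul_assoc (adMat k (W.P i)), hcomm1]
        simp only [mul_assoc]

end BlockRelation


section OnePair
variable {k : Type} [Field k] [NumberField k] (W : PlaneData k) (v : HeightOneSpectrum (𝓞 k))

/-- The column of a mapped rational matrix: `(M.map ι) *ᵥ e_j = ι ∘ M.col j`. -/
theorem map_mulVec_single (M : Matrix (Fin 4) (Fin 4) k) (j : Fin 4) :
    M.map (algebraMap k (v.adicCompletion k)) *ᵥ Pi.single j 1 = algebraMap k (v.adicCompletion k) ∘ M.col j := by
  rw [mulVec_single_one]
  funext a
  rfl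

/-- `ι ∘ e_j = e_j`. -/
theorem comp_single_one (j : Fin 2) :
    (algebraMap k (v.adicCompletion k) ∘ (Pi.single j 1 : Fin 2 → k)) = Pi.single j 1 := by
  funext a
  by_cases h : a = j
  · subst h; simp
  · simp [Pi.single_eq_of_ne h]

/-- A mapped rational matrix acting on a mapped rational vector. -/
theorem map_mulVec_comp {m n : Type} [Fintype n] (M : Matrix m n k) (w : n → k) :
    M.map (algebraMap k (v.adicCompletion k)) *ᵥ (algebraMap k (v.adicCompletion k) ∘ w) =
      algebraMap k (v.adicCompletion k) ∘ (M *ᵥ w) := by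
  funext a
  exact (RingHom.map_mulVec (algebraMap k (v.adicCompletion k)) M w a).symm

/-- **ONE PAIR `(i, j)`: the block scalar is `≡ 1`.**  With the local data at `v ∣ q` (the rational block
`P_i g₀ Q_j` with a non-zero column `j₀` and its coordinate matrix `R`; all rational constants bounded by `M ≥ 1`), for
`x, y ∈ K(qⁿ) γ₀,f K(qⁿ)` whose blocks are related by the scalar `esc A B` (`P_i y Q_j = esc A B · P_i x Q_j`), the
`v`-components of `A − 1` and `B` are `≤ M² δ`, `δ = M (|qⁿ|_v M) M`, provided `M² δ < 1`. -/
theorem block_scalar_near_one {γ₀ : GA W} {g₀ : Matrix (Fin 4) (Fin 4) k} (hg₀ : adMat k g₀ = GA.mat W γ₀)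
    (i j : Fin 2) (j₀ : Fin 4) {R : Matrix (Fin 2) (Fin 4) k}
    (hR0 : R *ᵥ (W.P i * g₀ * W.Q j).col j₀ = Pi.single 0 1)
    (hR1 : R *ᵥ (W.Ω *ᵥ (W.P i * g₀ * W.Q j).col j₀) = Pi.single 1 1)
    {M : WithZero (Multiplicative ℤ)} (hM : 1 ≤ M)
    (hgb : ∀ a b, Valued.v (algebraMap k (v.adicCompletion k) (g₀ a b)) ≤ M)
    (hPb : ∀ a b, Valued.v (algebraMap k (v.adicCompletion k) (W.P i a b)) ≤ M)
    (hQb : ∀ a b, Valued.v (algebraMap k (v.adicCompletion k) (W.Q j a b)) ≤ M)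
    (hΩb : ∀ a b, Valued.v (algebraMap k (v.adicCompletion k) (W.Ω a b)) ≤ M)
    (hRb : ∀ a b, Valued.v (algebraMap k (v.adicCompletion k) (R a b)) ≤ M)
    {N : ℕ} {x y : GA W} (hx : x ∈ levelDoubleCoset W N (GA.ofFinPart W γ₀))
    (hy : y ∈ levelDoubleCoset W N (GA.ofFinPart W γ₀)) {A B : Ad k}
    (hblock : adMat k (W.P i) * GA.mat W y * adMat k (W.Q j) =
      esc W A B * (adMat k (W.P i) * GA.mat W x * adMat k (W.Q j)))
    (hsmall : M * M * (M * (natSize k v N * M) * M) < 1) :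
    Valued.v (adComponentFin k v A - 1) ≤ M * M * (M * (natSize k v N * M) * M) ∧
      Valued.v (adComponentFin k v B) ≤ M * M * (M * (natSize k v N * M) * M) := by
  -- the local block identity
  have hloc : (W.P i).map (algebraMap k (v.adicCompletion k)) * (GA.mat W y).map (adComponentFin k v) *
      (W.Q j).map (algebraMap k (v.adicCompletion k)) =
      (adComponentFin k v A • (1 : Matrix (Fin 4) (Fin 4) (v.adicCompletion k)) +
        adComponentFin k v B • W.Ω.map (algebraMap k (v.adicCompletion k))) *
      ((W.P i).map (algebraMap k (v.adicCompletion k)) * (GA.mat W x).map (adComponentFin k v) *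
        (W.Q j).map (algebraMap k (v.adicCompletion k))) := by
    have h := congrArg (fun N : M4 k => N.map (adComponentFin k v)) hblock
    simp only [Matrix.map_mul, map_adMat, map_esc] at h
    exact h
  have hΓg : (GA.mat W γ₀).map (adComponentFin k v) = g₀.map (algebraMap k (v.adicCompletion k)) := by
    rw [← hg₀, map_adMat]
  set φ := adComponentFin k v with hφ
  set ι := algebraMap k (v.adicCompletion k) with hι
  set Γ := (GA.mat W γ₀).map φ with hΓ
  set X := (GA.mat W x).map φ with hX
  set Y := (GA.mat W y).map φ with hY
  set Pv := (W.P i).map ι with hPv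
  set Qv := (W.Q j).map ι with hQv
  set Ωv := W.Ω.map ι with hΩv
  set Rv := R.map ι with hRv
  -- the three columns
  set e : Fin 4 → v.adicCompletion k := Pi.single j₀ 1 with he
  set ξΓ := (Pv * Γ * Qv) *ᵥ e with hξΓ
  set ξX := (Pv * X * Qv) *ᵥ e with hξX
  set ξY := (Pv * Y * Qv) *ᵥ e with hξY
  have hξΓeq : ξΓ = ι ∘ (W.P i * g₀ * W.Q j).col j₀ := by
    rw [hξΓ, hΓg, hPv, hQv, ← Matrix.map_mul, ← Matrix.map_mul, he, map_mulVec_single]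
  have hR0v : Rv *ᵥ ξΓ = Pi.single 0 1 := by
    rw [hξΓeq, hRv, map_mulVec_comp, hR0, comp_single_one]
  have hR1v : Rv *ᵥ (Ωv *ᵥ ξΓ) = Pi.single 1 1 := by
    rw [hξΓeq, hΩv, map_mulVec_comp, hRv, map_mulVec_comp, hR1, comp_single_one]
  have hYξ : ξY = φ A • ξX + φ B • (Ωv *ᵥ ξX) := by
    rw [hξY, hloc, ← mulVec_mulVec, add_mulVec, smul_mulVec, smul_mulVec, one_mulVec, mulVec_mulVec]
  -- the bounds
  have hΓb : ∀ a b, Valued.v (Γ a b) ≤ M := by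
    intro a b
    rw [hΓg]
    exact hgb a b
  have hXΓ : ∀ a b, Valued.v ((X - Γ) a b) ≤ natSize k v N * M :=
    fun a b => map_sub_le_of_mem_levelDoubleCoset W v hx hΓb a b
  have hYΓ : ∀ a b, Valued.v ((Y - Γ) a b) ≤ natSize k v N * M :=
    fun a b => map_sub_le_of_mem_levelDoubleCoset W v hy hΓb a b
  have hPvb : ∀ a b, Valued.v (Pv a b) ≤ M := fun a b => hPb a b
  have hQvb : ∀ a b, Valued.v (Qv a b) ≤ M := fun a b => hQb a b
  have hΩvb : ∀ a b, Valued.v (Ωv a b) ≤ M := fun a b => hΩb a b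
  have hRvb : ∀ a b, Valued.v (Rv a b) ≤ M := fun a b => hRb a b
  have hcol : ∀ (Z : Matrix (Fin 4) (Fin 4) (v.adicCompletion k)) (l : Fin 4), (Z *ᵥ e) l = Z l j₀ := by
    intro Z l
    rw [he, mulVec_single_one]
    rfl
  have hXd : ∀ l, Valued.v (ξX l - ξΓ l) ≤ M * (natSize k v N * M) * M := by
    intro l
    have h : ξX l - ξΓ l = (Pv * (X - Γ) * Qv) l j₀ := by
      rw [hξX, hξΓ, hcol, hcol, Matrix.mul_sub, Matrix.sub_mul, Matrix.sub_apply]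
    rw [h]
    exact vmul_apply_le v (vmul_apply_le v hPvb hXΓ) hQvb l j₀
  have hYd : ∀ l, Valued.v (ξY l - ξΓ l) ≤ M * (natSize k v N * M) * M := by
    intro l
    have h : ξY l - ξΓ l = (Pv * (Y - Γ) * Qv) l j₀ := by
      rw [hξY, hξΓ, hcol, hcol, Matrix.mul_sub, Matrix.sub_mul, Matrix.sub_apply]
    rw [h]
    exact vmul_apply_le v (vmul_apply_le v hPvb hYΓ) hQvb l j₀
  exact coords_near_one Valued.v Rv Ωv ξΓ ξX ξY (φ A) (φ B) _ M hR0v hR1v hYξ hXd hYd hRvb hΩvb hM hsmall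

end OnePair

section ScalarAlgebra
variable {k : Type} [Field k] [NumberField k] (v : HeightOneSpectrum (𝓞 k))

/-- entries of a local `E′`-scalar `a • 1 + b • Ω_v`: `≤ max (vv a) (vv b · M)` when `Ω_v` is entrywise `≤ M`. -/
theorem scalar_apply_le {Ωv : Matrix (Fin 4) (Fin 4) (v.adicCompletion k)} {M : WithZero (Multiplicative ℤ)}
    (hΩb : ∀ l m, Valued.v (Ωv l m) ≤ M) (a b : v.adicCompletion k) (l m : Fin 4) :
    Valued.v ((a • (1 : Matrix (Fin 4) (Fin 4) (v.adicCompletion k)) + b • Ωv) l m) ≤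
      max (Valued.v a) (Valued.v b * M) := by
  rw [Matrix.add_apply, Matrix.smul_apply, Matrix.smul_apply, smul_eq_mul, smul_eq_mul]
  refine (Valuation.map_add _ _ _).trans (max_le_max ?_ ?_)
  · rw [map_mul]
    by_cases h : l = m
    · subst h; simp
    · simp [Matrix.one_apply_ne h]
  · rw [map_mul]
    exact mul_le_mul' le_rfl (hΩb l m)

/-- the product of two local scalars (`Ω_v² = −δ • 1`). -/
theorem scalar_mul_scalar {Ωv : Matrix (Fin 4) (Fin 4) (v.adicCompletion k)} {δ : v.adicCompletion k}
    (hΩ2 : Ωv * Ωv = -(δ • (1 : Matrix (Fin 4) (Fin 4) (v.adicCompletion k)))) (a₁ b₁ a₂ b₂ : v.adicCompletion k) :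
    (a₁ • (1 : Matrix (Fin 4) (Fin 4) (v.adicCompletion k)) + b₁ • Ωv) *
        (a₂ • (1 : Matrix (Fin 4) (Fin 4) (v.adicCompletion k)) + b₂ • Ωv) =
      (a₁ * a₂ - δ * (b₁ * b₂)) • (1 : Matrix (Fin 4) (Fin 4) (v.adicCompletion k)) + (a₁ * b₂ + b₁ * a₂) • Ωv := by
  simp only [add_mul, mul_add, smul_mul_assoc, mul_smul_comm, one_mul, mul_one, hΩ2]
  module

end ScalarAlgebra

section Helpers
variable {k : Type} [Field k] [NumberField k] (W : PlaneData k)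

/-- `esc A B − 1 = esc (A − 1) B`. -/
theorem esc_sub_one (A B : Ad k) : esc W A B - 1 = esc W (A - 1) B := by
  simp only [esc, sub_smul, one_smul]
  abel

/-- `Ω_v² = −(ι d) • 1` at `v`. -/
theorem map_Omega_sq (v : HeightOneSpectrum (𝓞 k)) {d : k}
    (hΩ : W.Ω * W.Ω = -(d • (1 : Matrix (Fin 4) (Fin 4) k))) :
    W.Ω.map (algebraMap k (v.adicCompletion k)) * W.Ω.map (algebraMap k (v.adicCompletion k)) =
      -(algebraMap k (v.adicCompletion k) d • (1 : Matrix (Fin 4) (Fin 4) (v.adicCompletion k))) := by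
  rw [← Matrix.map_mul, hΩ]
  ext i j
  simp only [Matrix.map_apply, Matrix.neg_apply, Matrix.smul_apply, Matrix.one_apply, smul_eq_mul, map_neg, map_mul]
  split_ifs <;> simp

/-- `s^n · (s⁻¹^c)^e = s^(n − e c)` for `e c ≤ n`, `s ≠ 0`. -/
theorem pow_mul_inv_pow_eq {s : WithZero (Multiplicative ℤ)} (hs : s ≠ 0) {n e c : ℕ} (h : e * c ≤ n) :
    s ^ n * (s⁻¹ ^ c) ^ e = s ^ (n - e * c) := by
  have hn : n = (n - e * c) + e * c := (Nat.sub_add_cancel h).symm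
  calc s ^ n * (s⁻¹ ^ c) ^ e = s ^ (n - e * c) * (s ^ (e * c) * s⁻¹ ^ (e * c)) := by
        rw [← pow_mul, mul_comm c e]
        conv_lhs => rw [hn, pow_add, mul_assoc]
    _ = s ^ (n - e * c) := by rw [← mul_pow, mul_inv_cancel₀ hs, one_pow, mul_one]

end Helpers


end Summit.Ventures.HodgeRepro.Tier4.Line4
end
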